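import Literature.Analysis.FluidPDE.Ferrari1993CommutatorFromMoser
import Literature.Analysis.FluidPDE.PeriodicCylinderGagliardoNirenberg
import HarnessLib

/-!
# Ferrari's Lemma 1 ii) in the periodic cylinder: the discharge of
`Ferrari1993_periodicCylinderMoserInequality`

Topic `Literature/Analysis/FluidPDE`. Seventh file of the decomposition of the named fact
`Literature.Analysis.FluidPDE.Ferrari1993_periodicCylinderH3Bound` (`Ferrari1993Continuation.lean`;
A. B. Ferrari, *On the blow-up of solutions of the 3-D Euler equations in a bounded domain*,
Comm. Math. Phys. **155** (1993) 277–294, proof of Thm 2, (4) ⇒ (7)). The file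
`Ferrari1993CommutatorFromMoser.lean` vendored **Lemma 1 ii)**, p. 280 — for `f ∈ H^s ∩ C¹(Ω̄)`,
`g ∈ H^{s−1} ∩ C(Ω̄)`, `|α| ≤ s`:
`‖D^α(fg) − f D^α g‖_{L²(Ω)} ≤ C{|f|_{H^s} |g|_{L^∞} + |f|_{W^{1,∞}} |g|_{H^{s−1}}}` ("easily derived
using extension operators … together with the free space versions of the estimates" of
Klainerman–Majda and Moser) — at `s = 3` on the period cell of the periodic cylinder, as the
named fact `Ferrari1993_periodicCylinderMoserInequality`, and proved the commutator estimate of the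
`H^s` energy inequality from it. Here the fact is **proved**:
`Ferrari1993_periodicCylinderMoserInequality_holds`.

## The proof

For a word `w = (a, b, c)` of basis directions (`D_w = ∂_c ∂_b ∂_a`, the tree's `iterDeriv`), the
Leibniz rule gives on the open cylinder (`iterDeriv_three_smul_sub_apply`)

`D_w(fg) − f D_w g = f_{abc} g + f_{ab} g_c + f_{ac} g_b + f_a g_{bc} + f_{bc} g_a + f_b g_{ac} + f_c g_{ab}`

(seven terms; three for `|w| = 2`, one for `|w| = 1`, none for the empty word). The terms with all
derivatives on `f` are bounded in `L²(cell)` by `‖D³f‖_{L²} ‖g‖_{L^∞} ≤ ‖f‖_{H³} ‖g‖_{L^∞}`, those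
with one derivative on `f` by `‖Df‖_{L^∞} ‖D²g‖_{L²} ≤ ‖f‖_{W^{1,∞}} ‖g‖_{H²}` (Hölder `L^∞ × L²`,
and single words are summands of the tree's sum-form Sobolev norm,
`eLpNorm_iterDeriv_le_eSobolevDomainNorm_of_le`). The genuinely interpolative terms `f_{ab} g_c` are
bounded by Hölder `L⁴ × L⁴ → L²` and the **Nirenberg `L⁴` inequality on the cell** proved in
`PeriodicCylinderGagliardoNirenberg.lean` (`exists_integral_norm_fderiv_pow_four_le'`:
`∫_cell ‖∂_v h‖⁴ ≤ C M² ‖v‖² ∫_cell (‖∂_v h‖² + ‖D ∂_v h‖²)` for `h` of class `C²` on the closed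
cylinder, `L`-periodic, `‖h‖ ≤ M`), here recast in Sobolev-norm form
(`exists_sq_eLpNorm_four_fderiv_le_cylinderCell`):
`‖∂ᵢ h‖²_{L⁴(cell)} ≤ C ‖h‖_{L^∞(cell)} ‖h‖_{H²(cell)}`, using that a continuous periodic function
on the closed cylinder is bounded by its essential supremum on the cell
(`enorm_le_eLpNorm_top_cylinderCell_of_isAxiallyPeriodic`) and `‖D ∂ᵢ h‖_{L²} ≤ C' ‖h‖_{H²}`
(`exists_eSobolevDomainNorm_fderiv_le`). Applied to `h = ∂_a f` (realised up to the boundary as a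
`fderivWithin` on the closed cylinder) and to `h = g`:
`‖f_{ab}‖²_{L⁴} ≤ C ‖f‖_{W^{1,∞}} ‖f‖_{H³}`, `‖g_c‖²_{L⁴} ≤ C ‖g‖_{L^∞} ‖g‖_{H²}`, whence
`‖f_{ab} g_c‖²_{L²} ≤ (C² ‖f‖_{H³} ‖g‖_{L^∞}) (‖f‖_{W^{1,∞}} ‖g‖_{H²})` and
`‖f_{ab} g_c‖_{L²} ≤ C² ‖f‖_{H³} ‖g‖_{L^∞} + ‖f‖_{W^{1,∞}} ‖g‖_{H²}` (`z² ≤ PQ ⇒ z ≤ P + Q`). This is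
the standard proof of the Moser/Klainerman–Majda calculus inequality at `s = 3` (Leibniz +
Hölder + Gagliardo–Nirenberg), the extension operator of the printed remark being replaced by
the `L⁴` inequality with boundary term of the sibling file. All statements other than the
discharge are folklore calculus / measure theory.

With this file and `Ferrari1993CommutatorFromMoser.lean`
(`Ferrari1993_periodicCylinderCommutatorEstimate_of_moser`) the commutator estimate
`Ferrari1993_periodicCylinderCommutatorEstimate` is discharged as well
(`Ferrari1993_periodicCylinderCommutatorEstimate_holds'`, primed to leave the unprimed name to a
direct proof), and the a-priori `H³` bound rests on Lemma 2 (the Neumann pressure estimate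
`Ferrari1993_periodicCylinderPressureEstimate`) and the stationary log div–curl estimate
`ShirotaYanagisawa1993_periodicCylinderLogDivCurlEstimate` alone
(`Ferrari1993_periodicCylinderH3Bound_of_pressure_of_divCurl`).

## Mathlib / tree search

`lean search 'MoserInequality_holds|CommutatorEstimate_holds'` — nothing; the `L⁴` inequality on the
cell: `PeriodicCylinderGagliardoNirenberg.lean` (imported); essential-supremum bounds for
continuous functions in the tree are for globally continuous functions and the full measure
(`FunctionSpaces.enorm_le_eLpNorm_top_of_continuous`, `SobolevDomainProofs.lean`), here an
open-set / `ContinuousOn` version is proved (`enorm_le_eLpNorm_top_of_continuousOn_isOpen`).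
Used from Mathlib: `fderiv_fun_smul`, `HasFDerivAt.add`, `Filter.EventuallyEq.fderiv_eq`,
`eLpNorm_smul_le_eLpNorm_mul_eLpNorm_top`, `eLpNorm_smul_le_eLpNorm_top_mul_eLpNorm`,
`eLpNorm_smul_le_mul_eLpNorm` (Hölder triple `(4,4,2)`), `eLpNorm_add_le`,
`eLpNorm_nnreal_pow_eq_lintegral`, `ofReal_integral_eq_lintegral_ofReal`,
`ENNReal.pow_le_pow_left_iff`, `ContinuousWithinAt.closure_le`, `IsOpen.measure_pos`; from the
tree: `eSobolevDomainNorm_eq_sum_iterDeriv`, `MeyersSerrin.eSobolevDomainNorm_succ_eq`,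
`SobolevApprox.eSobolevDomainNorm_congr`, `exists_eSobolevDomainNorm_fderiv_le`,
`IsAxiallyPeriodic.add_int_mul`, `isAxiallyPeriodic_fderivWithin_apply`,
`memLp_cylinderCell_of_continuousOn_closure`, `integrableOn_cylinderCell_of_continuousOn_closure`,
`aestronglyMeasurable_cylinderCell_of_continuousOn`.

## References

* A. B. Ferrari, *On the blow-up of solutions of the 3-D Euler equations in a bounded domain*,
  Comm. Math. Phys. 155 (1993) 277–294, Lemma 1 ii), p. 280. [Ferrari1993]
* S. Klainerman, A. Majda, *Singular limits of quasilinear hyperbolic systems with large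
  parameters and the incompressible limit of compressible fluids*, Comm. Pure Appl. Math. 34
  (1981) 481–524 (the calculus inequalities, Ferrari's [8]).
* L. Nirenberg, *On elliptic partial differential equations*, Ann. Scuola Norm. Sup. Pisa (3) 13
  (1959) 115–162, Lecture II.
-/

noncomputable section

open MeasureTheory Set Function Filter Topology TopologicalSpace WithLp
open scoped ContDiff NNReal ENNReal InnerProductSpace RealInnerProductSpace Pointwise

namespace Literature.Analysis.FluidPDE

open Literature.Analysis.FunctionSpaces


/-! ### Values of continuous functions are bounded by the essential supremum -/

section EssSup

variable {X : Type*} [MeasurableSpace X] [TopologicalSpace X] [OpensMeasurableSpace X]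
  {μ : Measure X} [μ.IsOpenPosMeasure]
variable {G : Type*} [NormedAddCommGroup G]

/-- **A function continuous on an open set is bounded there by its essential supremum** (for a
measure positive on nonempty open sets): `‖h x‖ ≤ ‖h‖_{L^∞(O)}` for `x ∈ O` — otherwise
`{‖h‖ > ‖h‖_{L^∞(O)}}` would be a nonempty open null subset of `O`. [folklore] -/
theorem enorm_le_eLpNorm_top_of_continuousOn_isOpen {O : Set X} (hO : IsOpen O) {h : X → G}
    (hh : ContinuousOn h O) {x : X} (hx : x ∈ O) :
    ‖h x‖ₑ ≤ eLpNorm h ∞ (μ.restrict O) := by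
  by_contra hlt
  push Not at hlt
  set S : ℝ≥0∞ := eLpNorm h ∞ (μ.restrict O) with hS
  have hae : ∀ᵐ y ∂(μ.restrict O), ‖h y‖ₑ ≤ S := by
    rw [hS, eLpNorm_exponent_top]
    exact enorm_ae_le_eLpNormEssSup h _
  set W : Set X := O ∩ (fun y => ‖h y‖ₑ) ⁻¹' Ioi S with hW_def
  have hW : IsOpen W := (continuous_enorm.comp_continuousOn hh).isOpen_inter_preimage hO isOpen_Ioi
  have hxW : x ∈ W := ⟨hx, hlt⟩
  have hpos : 0 < μ W := hW.measure_pos μ ⟨x, hxW⟩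
  have hzero : μ.restrict O W = 0 := by
    refine measure_mono_null (fun y hy => ?_) (ae_iff.1 hae)
    exact not_le.2 hy.2
  rw [Measure.restrict_apply hW.measurableSet, inter_eq_left.2 inter_subset_left] at hzero
  exact hpos.ne' hzero

end EssSup

/-- **A continuous periodic function on the closed cylinder is bounded by its essential supremum
on the period cell**: for `h` continuous on `{r ≤ 1}` and `L`-periodic in `z` (`L > 0`),
`‖h x‖ ≤ ‖h‖_{L^∞(cell)}` for every `x` with `r(x) ≤ 1`. On the open cell this is
`enorm_le_eLpNorm_top_of_continuousOn_isOpen`; a point `y` of the open cylinder is the limit of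
the points `y + t e_z`, `t ↓ 0`, which for small `t > 0` are translates by `⌊z/L⌋ L e_z` of
points of the open cell; the closed cylinder is the closure of the open one. [folklore] -/
theorem enorm_le_eLpNorm_top_cylinderCell_of_isAxiallyPeriodic {G : Type*} [NormedAddCommGroup G]
    {L : ℝ} (hL : 0 < L) {h : (EuclideanSpace ℝ (Fin 3)) → G} (hh : ContinuousOn h (closure
        (unitCylinder : Set (EuclideanSpace ℝ (Fin 3)))))
    (hper : IsAxiallyPeriodic L h) {x : (EuclideanSpace ℝ (Fin 3))} (hx : x ∈ closure (unitCylinder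
        : Set (EuclideanSpace ℝ (Fin 3)))) :
    ‖h x‖ₑ ≤ eLpNorm h ∞ (volume.restrict (cylinderCell L : Set (EuclideanSpace ℝ (Fin 3)))) := by
  set S : ℝ≥0∞ := eLpNorm h ∞ (volume.restrict (cylinderCell L : Set (EuclideanSpace ℝ (Fin 3))))
      with hS
  set ez : (EuclideanSpace ℝ (Fin 3)) := EuclideanSpace.single (2 : Fin 3) (1 : ℝ) with hez
  -- on the open cell
  have h1 : ∀ y ∈ (cylinderCell L : Set (EuclideanSpace ℝ (Fin 3))), ‖h y‖ₑ ≤ S := fun y hy =>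
    enorm_le_eLpNorm_top_of_continuousOn_isOpen (cylinderCell L).isOpen
      (hh.mono fun z hz => subset_closure (cylinderCell_le_unitCylinder L hz)) hy
  -- on the open cylinder, by the vertical approach
  have h2 : ∀ y ∈ (unitCylinder : Set (EuclideanSpace ℝ (Fin 3))), ‖h y‖ₑ ≤ S := by
    intro y hy
    set k : ℤ := ⌊y 2 / L⌋ with hk
    have hk1 : (k : ℝ) * L ≤ y 2 := by
      have := Int.floor_le (y 2 / L)
      rw [← hk] at this
      calc (k : ℝ) * L ≤ y 2 / L * L := mul_le_mul_of_nonneg_right this hL.le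
        _ = y 2 := div_mul_cancel₀ _ hL.ne'
    have hk2 : y 2 < ((k : ℝ) + 1) * L := by
      have := Int.lt_floor_add_one (y 2 / L)
      rw [← hk] at this
      calc y 2 = y 2 / L * L := (div_mul_cancel₀ _ hL.ne').symm
        _ < ((k : ℝ) + 1) * L := mul_lt_mul_of_pos_right this hL
    set δ : ℝ := ((k : ℝ) + 1) * L - y 2 with hδ
    have hδ0 : 0 < δ := sub_pos.2 hk2
    -- the approach `t ↦ y + t e_z`
    have hp : Tendsto (fun t : ℝ => y + t • ez) (𝓝[>] 0) (𝓝 y) := by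
      have : Tendsto (fun t : ℝ => y + t • ez) (𝓝 0) (𝓝 (y + (0 : ℝ) • ez)) :=
        tendsto_const_nhds.add (tendsto_id.smul tendsto_const_nhds)
      rw [zero_smul, add_zero] at this
      exact this.mono_left nhdsWithin_le_nhds
    have hcont : ContinuousAt h y := hh.continuousAt (closure_unitCylinder_mem_nhds hy)
    have hlim : Tendsto (fun t : ℝ => ‖h (y + t • ez)‖ₑ) (𝓝[>] 0) (𝓝 ‖h y‖ₑ) :=
      (continuous_enorm.continuousAt.tendsto.comp hcont.tendsto).comp hp
    refine le_of_tendsto hlim ?_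
    filter_upwards [Ioo_mem_nhdsGT hδ0] with t ht
    -- the translate of `y + t e_z` by `-k L e_z` lies in the open cell
    have hq : y + t • ez + (((-k : ℤ) : ℝ) * L) • ez ∈ (cylinderCell L : Set (EuclideanSpace ℝ (Fin
        3))) := by
      rw [SetLike.mem_coe, mem_cylinderCell]
      refine ⟨?_, ?_⟩
      · rw [hez, cylRadius_add_axialShift, cylRadius_add_axialShift]
        exact hy
      · have e2 : (y + t • ez + (((-k : ℤ) : ℝ) * L) • ez) 2 = y 2 + t - (k : ℝ) * L := by
          simp [hez]
          ring
        rw [e2]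
        constructor
        · linarith [ht.1]
        · have := ht.2
          rw [hδ] at this
          linarith
    calc ‖h (y + t • ez)‖ₑ = ‖h (y + t • ez + (((-k : ℤ) : ℝ) * L) • ez)‖ₑ := by
          rw [hez, hper.add_int_mul]
      _ ≤ S := h1 _ hq
  -- on the closed cylinder, by continuity
  have hcw : ContinuousWithinAt (fun y => ‖h y‖ₑ) (unitCylinder : Set (EuclideanSpace ℝ (Fin 3))) x
      :=
    ((continuous_enorm.comp_continuousOn hh).continuousWithinAt hx).mono subset_closure
  exact hcw.closure_le hx continuousWithinAt_const h2

/-- The real form: `‖h x‖ ≤ ‖h‖_{L^∞(cell)}` (a finite quantity) on the closed cylinder, for `h`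
continuous on `{r ≤ 1}` and `L`-periodic. [folklore] -/
theorem norm_le_toReal_eLpNorm_top_cylinderCell_of_isAxiallyPeriodic {G : Type*}
    [NormedAddCommGroup G] {L : ℝ} (hL : 0 < L) {h : (EuclideanSpace ℝ (Fin 3)) → G}
    (hh : ContinuousOn h (closure (unitCylinder : Set (EuclideanSpace ℝ (Fin 3))))) (hper :
        IsAxiallyPeriodic L h)
    {x : (EuclideanSpace ℝ (Fin 3))} (hx : x ∈ closure (unitCylinder : Set (EuclideanSpace ℝ (Fin
        3)))) :
    ‖h x‖ ≤ (eLpNorm h ∞ (volume.restrict (cylinderCell L : Set (EuclideanSpace ℝ (Fin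
        3))))).toReal := by
  have hfin : eLpNorm h ∞ (volume.restrict (cylinderCell L : Set (EuclideanSpace ℝ (Fin 3)))) < ⊤ :=
    (memLp_cylinderCell_of_continuousOn_closure L ∞ hh).2
  have h := enorm_le_eLpNorm_top_cylinderCell_of_isAxiallyPeriodic hL hh hper hx
  rw [← ofReal_norm] at h
  exact (ENNReal.ofReal_le_iff_le_toReal hfin.ne).1 h

/-! ### Leibniz expansions of `D_w (φ ψ)` for words of length `≤ 3` -/

section Leibniz

variable {E : Type*} [NormedAddCommGroup E] [NormedSpace ℝ E]
variable {F : Type*} [NormedAddCommGroup F] [NormedSpace ℝ F]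

/-- A word of length one: `D_{(a)} f = ∂_a f`. [folklore] -/
theorem iterDeriv_one_eq (v : Fin 1 → E) (f : E → F) :
    iterDeriv 1 v f = fun x => fderiv ℝ f x (v 0) := rfl

/-- A word of length two: `D_{(a,b)} f = ∂_b ∂_a f`. [folklore] -/
theorem iterDeriv_two_eq (v : Fin 2 → E) (f : E → F) :
    iterDeriv 2 v f = fun x => fderiv ℝ (fun y => fderiv ℝ f y (v 0)) x (v 1) := rfl

/-- A word of length three: `D_{(a,b,c)} f = ∂_c ∂_b ∂_a f`. [folklore] -/
theorem iterDeriv_three_eq (v : Fin 3 → E) (f : E → F) :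
    iterDeriv 3 v f =
      fun x => fderiv ℝ (fun y => fderiv ℝ (fun z => fderiv ℝ f z (v 0)) y (v 1)) x (v 2) := rfl

variable {U : Set E} {φ : E → ℝ} {ψ : E → F}

/-- **Leibniz, order one**: `∂_a(φ ψ) = (∂_a φ) ψ + φ ∂_a ψ` on an open set where `φ, ψ` are
`C^∞`. [folklore] -/
theorem fderiv_smul_apply_of_isOpen (hU : IsOpen U) (hφ : ContDiffOn ℝ ∞ φ U)
    (hψ : ContDiffOn ℝ ∞ ψ U) (a : E) {x : E} (hx : x ∈ U) :
    fderiv ℝ (fun y => φ y • ψ y) x a = fderiv ℝ φ x a • ψ x + φ x • fderiv ℝ ψ x a := by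
  rw [fderiv_fun_smul (differentiableAt_of_contDiffOn_isOpen hU hφ hx)
    (differentiableAt_of_contDiffOn_isOpen hU hψ hx)]
  simp only [_root_.add_apply, FunLike.coe_smul, Pi.smul_apply,
    ContinuousLinearMap.smulRight_apply]
  rw [add_comm]

/-- **Leibniz, order two**: `∂_b ∂_a(φ ψ) = (∂_b∂_a φ) ψ + (∂_a φ)(∂_b ψ) + (∂_b φ)(∂_a ψ) + φ ∂_b∂_a ψ`
on an open set where `φ, ψ` are `C^∞`. [folklore] -/
theorem fderiv_fderiv_smul_apply_of_isOpen (hU : IsOpen U) (hφ : ContDiffOn ℝ ∞ φ U)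
    (hψ : ContDiffOn ℝ ∞ ψ U) (a b : E) {x : E} (hx : x ∈ U) :
    fderiv ℝ (fun y => fderiv ℝ (fun z => φ z • ψ z) y a) x b =
      fderiv ℝ (fun y => fderiv ℝ φ y a) x b • ψ x + fderiv ℝ φ x a • fderiv ℝ ψ x b +
        fderiv ℝ φ x b • fderiv ℝ ψ x a + φ x • fderiv ℝ (fun y => fderiv ℝ ψ y a) x b := by
  have hφa : ContDiffOn ℝ ∞ (fun y => fderiv ℝ φ y a) U := contDiffOn_fderiv_apply_of_isOpen hU hφ a
  have hψa : ContDiffOn ℝ ∞ (fun y => fderiv ℝ ψ y a) U := contDiffOn_fderiv_apply_of_isOpen hU hψ a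
  have heq : (fun y => fderiv ℝ (fun z => φ z • ψ z) y a) =ᶠ[𝓝 x]
      fun y => fderiv ℝ φ y a • ψ y + φ y • fderiv ℝ ψ y a :=
    eventuallyEq_of_mem (hU.mem_nhds hx) fun y hy => fderiv_smul_apply_of_isOpen hU hφ hψ a hy
  have d1 : DifferentiableAt ℝ (fun y => fderiv ℝ φ y a • ψ y) x :=
    differentiableAt_of_contDiffOn_isOpen hU (hφa.smul hψ) hx
  have d2 : DifferentiableAt ℝ (fun y => φ y • fderiv ℝ ψ y a) x :=
    differentiableAt_of_contDiffOn_isOpen hU (hφ.smul hψa) hx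
  have H : HasFDerivAt (fun y => fderiv ℝ φ y a • ψ y + φ y • fderiv ℝ ψ y a)
      (fderiv ℝ (fun y => fderiv ℝ φ y a • ψ y) x + fderiv ℝ (fun y => φ y • fderiv ℝ ψ y a) x) x :=
    d1.hasFDerivAt.add d2.hasFDerivAt
  rw [heq.fderiv_eq, H.fderiv, _root_.add_apply, fderiv_smul_apply_of_isOpen hU hφa hψ b hx,
    fderiv_smul_apply_of_isOpen hU hφ hψa b hx]
  abel

/-- **Leibniz, order three** (eight terms): on an open set where `φ, ψ` are `C^∞`,
`∂_c∂_b∂_a(φ ψ) = φ_{abc} ψ + φ_{ab} ψ_c + φ_{ac} ψ_b + φ_a ψ_{bc} + φ_{bc} ψ_a + φ_b ψ_{ac} + φ_c ψ_{ab} + φ ψ_{abc}`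
(subscripts = successive directional derivatives, leftmost first). [folklore] -/
theorem fderiv_fderiv_fderiv_smul_apply_of_isOpen (hU : IsOpen U) (hφ : ContDiffOn ℝ ∞ φ U)
    (hψ : ContDiffOn ℝ ∞ ψ U) (a b c : E) {x : E} (hx : x ∈ U) :
    fderiv ℝ (fun y => fderiv ℝ (fun z => fderiv ℝ (fun t => φ t • ψ t) z a) y b) x c =
      fderiv ℝ (fun y => fderiv ℝ (fun z => fderiv ℝ φ z a) y b) x c • ψ x +
      fderiv ℝ (fun z => fderiv ℝ φ z a) x b • fderiv ℝ ψ x c +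
      fderiv ℝ (fun z => fderiv ℝ φ z a) x c • fderiv ℝ ψ x b +
      fderiv ℝ φ x a • fderiv ℝ (fun z => fderiv ℝ ψ z b) x c +
      fderiv ℝ (fun z => fderiv ℝ φ z b) x c • fderiv ℝ ψ x a +
      fderiv ℝ φ x b • fderiv ℝ (fun z => fderiv ℝ ψ z a) x c +
      fderiv ℝ φ x c • fderiv ℝ (fun z => fderiv ℝ ψ z a) x b +
      φ x • fderiv ℝ (fun y => fderiv ℝ (fun z => fderiv ℝ ψ z a) y b) x c := by
  have hφa : ContDiffOn ℝ ∞ (fun y => fderiv ℝ φ y a) U := contDiffOn_fderiv_apply_of_isOpen hU hφ a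
  have hψa : ContDiffOn ℝ ∞ (fun y => fderiv ℝ ψ y a) U := contDiffOn_fderiv_apply_of_isOpen hU hψ a
  have hφb : ContDiffOn ℝ ∞ (fun y => fderiv ℝ φ y b) U := contDiffOn_fderiv_apply_of_isOpen hU hφ b
  have hψb : ContDiffOn ℝ ∞ (fun y => fderiv ℝ ψ y b) U := contDiffOn_fderiv_apply_of_isOpen hU hψ b
  have hφab : ContDiffOn ℝ ∞ (fun y => fderiv ℝ (fun z => fderiv ℝ φ z a) y b) U :=
    contDiffOn_fderiv_apply_of_isOpen hU hφa b
  have hψab : ContDiffOn ℝ ∞ (fun y => fderiv ℝ (fun z => fderiv ℝ ψ z a) y b) U :=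
    contDiffOn_fderiv_apply_of_isOpen hU hψa b
  have heq : (fun y => fderiv ℝ (fun z => fderiv ℝ (fun t => φ t • ψ t) z a) y b) =ᶠ[𝓝 x]
      fun y => fderiv ℝ (fun z => fderiv ℝ φ z a) y b • ψ y + fderiv ℝ φ y a • fderiv ℝ ψ y b +
        fderiv ℝ φ y b • fderiv ℝ ψ y a + φ y • fderiv ℝ (fun z => fderiv ℝ ψ z a) y b :=
    eventuallyEq_of_mem (hU.mem_nhds hx) fun y hy =>
      fderiv_fderiv_smul_apply_of_isOpen hU hφ hψ a b hy
  have d1 : DifferentiableAt ℝ (fun y => fderiv ℝ (fun z => fderiv ℝ φ z a) y b • ψ y) x :=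
    differentiableAt_of_contDiffOn_isOpen hU (hφab.smul hψ) hx
  have d2 : DifferentiableAt ℝ (fun y => fderiv ℝ φ y a • fderiv ℝ ψ y b) x :=
    differentiableAt_of_contDiffOn_isOpen hU (hφa.smul hψb) hx
  have d3 : DifferentiableAt ℝ (fun y => fderiv ℝ φ y b • fderiv ℝ ψ y a) x :=
    differentiableAt_of_contDiffOn_isOpen hU (hφb.smul hψa) hx
  have d4 : DifferentiableAt ℝ (fun y => φ y • fderiv ℝ (fun z => fderiv ℝ ψ z a) y b) x :=
    differentiableAt_of_contDiffOn_isOpen hU (hφ.smul hψab) hx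
  have H : HasFDerivAt (fun y => fderiv ℝ (fun z => fderiv ℝ φ z a) y b • ψ y +
        fderiv ℝ φ y a • fderiv ℝ ψ y b + fderiv ℝ φ y b • fderiv ℝ ψ y a +
        φ y • fderiv ℝ (fun z => fderiv ℝ ψ z a) y b)
      (fderiv ℝ (fun y => fderiv ℝ (fun z => fderiv ℝ φ z a) y b • ψ y) x +
        fderiv ℝ (fun y => fderiv ℝ φ y a • fderiv ℝ ψ y b) x +
        fderiv ℝ (fun y => fderiv ℝ φ y b • fderiv ℝ ψ y a) x +
        fderiv ℝ (fun y => φ y • fderiv ℝ (fun z => fderiv ℝ ψ z a) y b) x) x :=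
    ((d1.hasFDerivAt.add d2.hasFDerivAt).add d3.hasFDerivAt).add d4.hasFDerivAt
  rw [heq.fderiv_eq, H.fderiv]
  simp only [_root_.add_apply]
  rw [fderiv_smul_apply_of_isOpen hU hφab hψ c hx, fderiv_smul_apply_of_isOpen hU hφa hψb c hx,
    fderiv_smul_apply_of_isOpen hU hφb hψa c hx, fderiv_smul_apply_of_isOpen hU hφ hψab c hx]
  abel

/-- **The commutator for a word of length one**: `D_{(a)}(φ ψ) − φ D_{(a)} ψ = (∂_a φ) ψ`.
[folklore] -/
theorem iterDeriv_one_smul_sub_apply (hU : IsOpen U) (hφ : ContDiffOn ℝ ∞ φ U)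
    (hψ : ContDiffOn ℝ ∞ ψ U) (v : Fin 1 → E) {x : E} (hx : x ∈ U) :
    iterDeriv 1 v (fun y => φ y • ψ y) x - φ x • iterDeriv 1 v ψ x = fderiv ℝ φ x (v 0) • ψ x := by
  rw [iterDeriv_one_eq, iterDeriv_one_eq]
  dsimp only
  rw [fderiv_smul_apply_of_isOpen hU hφ hψ (v 0) hx, add_sub_cancel_right]

/-- **The commutator for a word of length two** (three terms):
`D_{(a,b)}(φ ψ) − φ D_{(a,b)} ψ = φ_{ab} ψ + φ_a ψ_b + φ_b ψ_a`. [folklore] -/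
theorem iterDeriv_two_smul_sub_apply (hU : IsOpen U) (hφ : ContDiffOn ℝ ∞ φ U)
    (hψ : ContDiffOn ℝ ∞ ψ U) (v : Fin 2 → E) {x : E} (hx : x ∈ U) :
    iterDeriv 2 v (fun y => φ y • ψ y) x - φ x • iterDeriv 2 v ψ x =
      fderiv ℝ (fun y => fderiv ℝ φ y (v 0)) x (v 1) • ψ x +
        fderiv ℝ φ x (v 0) • fderiv ℝ ψ x (v 1) + fderiv ℝ φ x (v 1) • fderiv ℝ ψ x (v 0) := by
  rw [iterDeriv_two_eq, iterDeriv_two_eq]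
  dsimp only
  rw [fderiv_fderiv_smul_apply_of_isOpen hU hφ hψ (v 0) (v 1) hx, add_sub_cancel_right]

/-- **The commutator for a word of length three** (seven terms):
`D_{(a,b,c)}(φ ψ) − φ D_{(a,b,c)} ψ = φ_{abc} ψ + φ_{ab} ψ_c + φ_{ac} ψ_b + φ_a ψ_{bc} + φ_{bc} ψ_a + φ_b ψ_{ac} + φ_c ψ_{ab}`.
[folklore] -/
theorem iterDeriv_three_smul_sub_apply (hU : IsOpen U) (hφ : ContDiffOn ℝ ∞ φ U)
    (hψ : ContDiffOn ℝ ∞ ψ U) (v : Fin 3 → E) {x : E} (hx : x ∈ U) :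
    iterDeriv 3 v (fun y => φ y • ψ y) x - φ x • iterDeriv 3 v ψ x =
      fderiv ℝ (fun y => fderiv ℝ (fun z => fderiv ℝ φ z (v 0)) y (v 1)) x (v 2) • ψ x +
      fderiv ℝ (fun z => fderiv ℝ φ z (v 0)) x (v 1) • fderiv ℝ ψ x (v 2) +
      fderiv ℝ (fun z => fderiv ℝ φ z (v 0)) x (v 2) • fderiv ℝ ψ x (v 1) +
      fderiv ℝ φ x (v 0) • fderiv ℝ (fun z => fderiv ℝ ψ z (v 1)) x (v 2) +
      fderiv ℝ (fun z => fderiv ℝ φ z (v 1)) x (v 2) • fderiv ℝ ψ x (v 0) +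
      fderiv ℝ φ x (v 1) • fderiv ℝ (fun z => fderiv ℝ ψ z (v 0)) x (v 2) +
      fderiv ℝ φ x (v 2) • fderiv ℝ (fun z => fderiv ℝ ψ z (v 0)) x (v 1) := by
  rw [iterDeriv_three_eq, iterDeriv_three_eq]
  dsimp only
  rw [fderiv_fderiv_fderiv_smul_apply_of_isOpen hU hφ hψ (v 0) (v 1) (v 2) hx, add_sub_cancel_right]

end Leibniz

/-! ### Single words in the Sobolev norm of a smooth function -/

section Words

variable {E : Type*} [NormedAddCommGroup E] [NormedSpace ℝ E] [FiniteDimensional ℝ E]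
  [MeasurableSpace E] [BorelSpace E] {μ : Measure E} [μ.IsAddHaarMeasure]
variable {F : Type*} [NormedAddCommGroup F] [NormedSpace ℝ F] [CompleteSpace F]

/-- **One word is bounded by the Sobolev norm**: for `f` of class `C^∞` on the open set `Ω` and a
word `w` of length `m ≤ k` in the basis `(eᵢ) = Module.finBasis ℝ E`,
`‖D_w f‖_{L^p(Ω)} ≤ ‖f‖_{W^{k,p}(Ω)}` (one term of the word expansion
`eSobolevDomainNorm_eq_sum_iterDeriv`). [folklore] -/
theorem eLpNorm_iterDeriv_le_eSobolevDomainNorm_of_le {Ω : Opens E} (p : ℝ≥0∞) {k m : ℕ} (hmk : m ≤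
    k)
    (w : Fin m → Fin (Module.finrank ℝ E)) {f : E → F} (hf : ContDiffOn ℝ ∞ f Ω) :
    eLpNorm (iterDeriv m (fun j => Module.finBasis ℝ E (w j)) f) p (μ.restrict Ω) ≤
      eSobolevDomainNorm k p Ω μ f := by
  rw [eSobolevDomainNorm_eq_sum_iterDeriv p k hf]
  have h1 : eLpNorm (iterDeriv m (fun j => Module.finBasis ℝ E (w j)) f) p (μ.restrict Ω) ≤
      ∑ w' : Fin m → Fin (Module.finrank ℝ E),
        eLpNorm (iterDeriv m (fun j => Module.finBasis ℝ E (w' j)) f) p (μ.restrict Ω) :=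
    Finset.single_le_sum (f := fun w' : Fin m → Fin (Module.finrank ℝ E) =>
      eLpNorm (iterDeriv m (fun j => Module.finBasis ℝ E (w' j)) f) p (μ.restrict Ω))
      (fun _ _ => zero_le) (Finset.mem_univ w)
  refine h1.trans ?_
  exact Finset.single_le_sum (f := fun m' => ∑ w' : Fin m' → Fin (Module.finrank ℝ E),
      eLpNorm (iterDeriv m' (fun j => Module.finBasis ℝ E (w' j)) f) p (μ.restrict Ω))
    (fun _ _ => zero_le) (Finset.mem_range.2 (Nat.lt_succ_of_le hmk))

/-- `‖∂ᵢ f‖_{L^p(Ω)} ≤ ‖f‖_{W^{k,p}(Ω)}` for `k ≥ 1` and `f` smooth on `Ω` (the word `(i)`).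
[folklore] -/
theorem eLpNorm_fderiv_basis_le_eSobolevDomainNorm {Ω : Opens E} (p : ℝ≥0∞) {k : ℕ} (hk : 1 ≤ k)
    (i : Fin (Module.finrank ℝ E)) {f : E → F} (hf : ContDiffOn ℝ ∞ f Ω) :
    eLpNorm (fun x => fderiv ℝ f x (Module.finBasis ℝ E i)) p (μ.restrict Ω) ≤
      eSobolevDomainNorm k p Ω μ f := by
  have h := eLpNorm_iterDeriv_le_eSobolevDomainNorm_of_le (μ := μ) p hk ![i] hf
  rw [iterDeriv_one_eq] at h
  simpa using h

/-- `‖∂ⱼ ∂ᵢ f‖_{L^p(Ω)} ≤ ‖f‖_{W^{k,p}(Ω)}` for `k ≥ 2` and `f` smooth on `Ω` (the word `(i, j)`).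
[folklore] -/
theorem eLpNorm_fderiv_fderiv_basis_le_eSobolevDomainNorm {Ω : Opens E} (p : ℝ≥0∞) {k : ℕ}
    (hk : 2 ≤ k) (i j : Fin (Module.finrank ℝ E)) {f : E → F} (hf : ContDiffOn ℝ ∞ f Ω) :
    eLpNorm (fun x => fderiv ℝ (fun y => fderiv ℝ f y (Module.finBasis ℝ E i)) x
      (Module.finBasis ℝ E j)) p (μ.restrict Ω) ≤ eSobolevDomainNorm k p Ω μ f := by
  have h := eLpNorm_iterDeriv_le_eSobolevDomainNorm_of_le (μ := μ) p hk ![i, j] hf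
  rw [iterDeriv_two_eq] at h
  simpa using h

/-- `‖∂ₗ ∂ⱼ ∂ᵢ f‖_{L^p(Ω)} ≤ ‖f‖_{W^{k,p}(Ω)}` for `k ≥ 3` and `f` smooth on `Ω` (the word
`(i, j, l)`). [folklore] -/
theorem eLpNorm_fderiv_fderiv_fderiv_basis_le_eSobolevDomainNorm {Ω : Opens E} (p : ℝ≥0∞)
    {k : ℕ} (hk : 3 ≤ k) (i j l : Fin (Module.finrank ℝ E)) {f : E → F}
    (hf : ContDiffOn ℝ ∞ f Ω) :
    eLpNorm (fun x => fderiv ℝ (fun y => fderiv ℝ (fun z => fderiv ℝ f z (Module.finBasis ℝ E i)) y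
      (Module.finBasis ℝ E j)) x (Module.finBasis ℝ E l)) p (μ.restrict Ω) ≤
      eSobolevDomainNorm k p Ω μ f := by
  have h := eLpNorm_iterDeriv_le_eSobolevDomainNorm_of_le (μ := μ) p hk ![i, j, l] hf
  rw [iterDeriv_three_eq] at h
  simpa using h

/-- **One branch of the recursion**: `‖∂ᵢ f‖_{W^{k,p}(Ω)} ≤ ‖f‖_{W^{k+1,p}(Ω)}` for `f` smooth on
`Ω` (the infimum in the definition of the norm is attained at the classical derivative,
`MeyersSerrin.eSobolevDomainNorm_succ_eq`). [folklore] -/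
theorem eSobolevDomainNorm_fderiv_basis_le_succ {Ω : Opens E} (p : ℝ≥0∞) (k : ℕ)
    (i : Fin (Module.finrank ℝ E)) {f : E → F} (hf : ContDiffOn ℝ ∞ f Ω) :
    eSobolevDomainNorm k p Ω μ (fun x => fderiv ℝ f x (Module.finBasis ℝ E i)) ≤
      eSobolevDomainNorm (k + 1) p Ω μ f := by
  rw [MeyersSerrin.eSobolevDomainNorm_succ_eq (p := p) (k := k)
    (MeyersSerrin.hasWeakFDerivOn_of_contDiffOn (μ := μ) hf)]
  refine le_add_left ?_
  exact Finset.single_le_sum (f := fun j => eSobolevDomainNorm k p Ω μ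
    fun x => fderiv ℝ f x (Module.finBasis ℝ E j)) (fun _ _ => zero_le) (Finset.mem_univ i)

end Words

/-! ### The `L⁴` interpolation inequality in Sobolev-norm form -/

section L4

variable {F : Type*} [NormedAddCommGroup F] [InnerProductSpace ℝ F] [CompleteSpace F]

/-- `∫⁻ ‖g‖ₑ⁴ = ‖g‖⁴_{L⁴}`, the instance of `eLpNorm_nnreal_pow_eq_lintegral` used below (the
square instance `∫⁻ ‖g‖ₑ² = ‖g‖²_{L²}` is `lintegral_enorm_sq_eq_eLpNorm_two_sq`,
`EnstrophySplitting.lean`). [folklore] -/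
theorem lintegral_enorm_pow_four_eq {α : Type*} [MeasurableSpace α] (ν : Measure α)
    {G : Type*} [NormedAddCommGroup G] (g : α → G) : ∫⁻ x, ‖g x‖ₑ ^ 4 ∂ν = eLpNorm g 4 ν ^ 4 := by
  have h := eLpNorm_nnreal_pow_eq_lintegral (f := g) (μ := ν) (p := (4 : ℝ≥0)) (by norm_num)
  simp only [ENNReal.coe_ofNat, NNReal.coe_ofNat, ENNReal.rpow_ofNat] at h
  exact h.symm

/-- `z² ≤ c w²`, `c ≤ C` and `1 ≤ C` give `z ≤ C w` in `ℝ≥0∞`. [folklore] -/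
theorem ennreal_le_mul_of_sq_le_mul_sq {z w c C : ℝ≥0∞} (h : z ^ 2 ≤ c * w ^ 2) (hcC : c ≤ C)
    (hC : 1 ≤ C) : z ≤ C * w := by
  have h2 : z ^ 2 ≤ (C * w) ^ 2 := by
    calc z ^ 2 ≤ c * w ^ 2 := h
      _ ≤ C * w ^ 2 := mul_le_mul' hcC le_rfl
      _ ≤ (C * C) * w ^ 2 := mul_le_mul' (le_mul_of_one_le_left (zero_le) hC) le_rfl
      _ = (C * w) ^ 2 := by ring
  exact (ENNReal.pow_le_pow_left_iff two_ne_zero).1 h2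

/-- **The `L⁴` interpolation inequality on the period cell, Sobolev form**: for `L > 0` there is
`C` such that for every `h` of class `C^∞` on the closed cylinder `{r ≤ 1}` and `L`-periodic in
`z`, and every basis direction `eᵢ` of the tree's Sobolev norm,
`‖∂ᵢ h‖²_{L⁴(cell)} ≤ C ‖h‖_{L^∞(cell)} ‖h‖_{H²(cell)}`. This is
`exists_integral_norm_fderiv_pow_four_le'` (Nirenberg's inequality `∫‖∂_v h‖⁴ ≤ C M² ‖v‖² ∫(‖∂_v h‖² + ‖D∂_v h‖²)`
with `M = sup ‖h‖`) combined with `sup_{r ≤ 1} ‖h‖ = ‖h‖_{L^∞(cell)}`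
(`norm_le_toReal_eLpNorm_top_cylinderCell_of_isAxiallyPeriodic`), `‖∂ᵢ h‖_{L²} ≤ ‖h‖_{H²}` and
`‖D ∂ᵢ h‖_{L²} ≤ C' ‖∂ᵢ h‖_{H¹} ≤ C' ‖h‖_{H²}` (`exists_eSobolevDomainNorm_fderiv_le`).
[cite: Ferrari1993, Lemma 1 ii) p. 280 (the free-space estimate it rests on: Nirenberg 1959, Lecture II)] -/
theorem exists_sq_eLpNorm_four_fderiv_le_cylinderCell {L : ℝ} (hL : 0 < L) :
    ∃ C : ℝ≥0, ∀ (h : (EuclideanSpace ℝ (Fin 3)) → F), ContDiffOn ℝ ∞ h (closure (unitCylinder :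
        Set (EuclideanSpace ℝ (Fin 3)))) →
      IsAxiallyPeriodic L h → ∀ i : Fin (Module.finrank ℝ (EuclideanSpace ℝ (Fin 3))),
      eLpNorm (fun x => fderiv ℝ h x (Module.finBasis ℝ (EuclideanSpace ℝ (Fin 3)) i)) 4
          (volume.restrict (cylinderCell L : Set (EuclideanSpace ℝ (Fin 3)))) ^ 2 ≤
        C * eLpNorm h ∞ (volume.restrict (cylinderCell L : Set (EuclideanSpace ℝ (Fin 3)))) *
          eSobolevDomainNorm 2 2 (cylinderCell L) volume h := by
  obtain ⟨C₁, hC₁0, hGN⟩ := exists_integral_norm_fderiv_pow_four_le' (F := F)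
  obtain ⟨C₂, hC₂⟩ := exists_eSobolevDomainNorm_fderiv_le (E' := (EuclideanSpace ℝ (Fin 3))) (F :=
      F) (μ := volume)
    (Ω := cylinderCell L) (p := 2) one_le_two
  set b := Module.finBasis ℝ (EuclideanSpace ℝ (Fin 3)) with hb
  -- the constant
  set c : Fin (Module.finrank ℝ (EuclideanSpace ℝ (Fin 3))) → ℝ≥0 := fun i => Real.toNNReal (C₁ *
      ‖b i‖ ^ 2) * (1 + C₂ ^ 2)
    with hc
  refine ⟨1 + ∑ i, c i, fun h hh hper i => ?_⟩
  -- notation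
  set K : Set (EuclideanSpace ℝ (Fin 3)) := closure (unitCylinder : Set (EuclideanSpace ℝ (Fin 3)))
      with hK_def
  set Ω : Set (EuclideanSpace ℝ (Fin 3)) := (cylinderCell L : Set (EuclideanSpace ℝ (Fin 3))) with
      hΩ_def
  set μ : Measure (EuclideanSpace ℝ (Fin 3)) := volume.restrict Ω with hμ
  have hKu : UniqueDiffOn ℝ K := uniqueDiffOn_closure_unitCylinder
  have hU : IsOpen (unitCylinder : Set (EuclideanSpace ℝ (Fin 3))) := unitCylinder.isOpen
  have hΩU : Ω ⊆ (unitCylinder : Set (EuclideanSpace ℝ (Fin 3))) := cylinderCell_le_unitCylinder L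
  have hΩm : MeasurableSet Ω := (cylinderCell L).isOpen.measurableSet
  have hnhds : ∀ x ∈ (unitCylinder : Set (EuclideanSpace ℝ (Fin 3))), K ∈ 𝓝 x := fun x hx =>
      closure_unitCylinder_mem_nhds hx
  have hhU : ContDiffOn ℝ ∞ h (unitCylinder : Set (EuclideanSpace ℝ (Fin 3))) := hh.mono
      subset_closure
  have hhΩ : ContDiffOn ℝ ∞ h (cylinderCell L) := hhU.mono hΩU
  set v : (EuclideanSpace ℝ (Fin 3)) := b i with hv
  -- the derivative fields, classical and up to the boundary
  set w : (EuclideanSpace ℝ (Fin 3)) → F := fun x => fderiv ℝ h x v with hw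
  set wK : (EuclideanSpace ℝ (Fin 3)) → F := fun x => fderivWithin ℝ h K x v with hwK
  set Dw : (EuclideanSpace ℝ (Fin 3)) → (EuclideanSpace ℝ (Fin 3)) →L[ℝ] F := fun x => fderiv ℝ w x
      with hDw
  set DwK : (EuclideanSpace ℝ (Fin 3)) → (EuclideanSpace ℝ (Fin 3)) →L[ℝ] F := fun x =>
      fderivWithin ℝ wK K x with hDwK
  have hwKs : ContDiffOn ℝ ∞ wK K := (hh.fderivWithin hKu (by simp)).clm_apply contDiffOn_const
  have hDwKc : ContinuousOn DwK K := hwKs.continuousOn_fderivWithin hKu (by simp)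
  have hwU : EqOn wK w (unitCylinder : Set (EuclideanSpace ℝ (Fin 3))) := fun x hx => by
    show fderivWithin ℝ h K x v = fderiv ℝ h x v
    rw [fderivWithin_of_mem_nhds (hnhds x hx)]
  have hDwU : EqOn DwK Dw (unitCylinder : Set (EuclideanSpace ℝ (Fin 3))) := fun x hx => by
    show fderivWithin ℝ wK K x = fderiv ℝ w x
    rw [fderivWithin_of_mem_nhds (hnhds x hx)]
    exact (eventuallyEq_of_mem (hU.mem_nhds hx) hwU).fderiv_eq
  have hwsU : ContDiffOn ℝ ∞ w (unitCylinder : Set (EuclideanSpace ℝ (Fin 3))) :=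
      contDiffOn_fderiv_apply_of_isOpen hU hhU v
  have hwsΩ : ContDiffOn ℝ ∞ w (cylinderCell L) := hwsU.mono hΩU
  have hw_meas : AEStronglyMeasurable w μ := aestronglyMeasurable_cylinderCell_of_continuousOn L
      hwsU.continuousOn
  -- the sup bound
  set S : ℝ≥0∞ := eLpNorm h ∞ μ with hS_def
  have hSfin : S < ⊤ := (memLp_cylinderCell_of_continuousOn_closure L ∞ hh.continuousOn).2
  set M : ℝ := S.toReal with hM_def
  have hM : ∀ x ∈ K, ‖h x‖ ≤ M := fun x hx =>
    norm_le_toReal_eLpNorm_top_cylinderCell_of_isAxiallyPeriodic hL hh.continuousOn hper hx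
  have hM0 : 0 ≤ M := ENNReal.toReal_nonneg
  -- Nirenberg's inequality
  have hGN' := hGN L hL h (hh.of_le (WithTop.coe_le_coe.mpr le_top)) hper M hM v
  -- the left-hand side in `ℝ≥0∞`
  have hI4 : ENNReal.ofReal (∫ x in Ω, ‖fderiv ℝ h x v‖ ^ 4) = eLpNorm w 4 μ ^ 4 := by
    have hint : IntegrableOn (fun x => ‖fderiv ℝ h x v‖ ^ 4) Ω volume := by
      refine IntegrableOn.congr_fun (integrableOn_cylinderCell_of_continuousOn_closure L
        ((hwKs.continuousOn.norm).pow 4)) (fun x hx => ?_) hΩm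
      show ‖wK x‖ ^ 4 = ‖fderiv ℝ h x v‖ ^ 4
      rw [hwU (hΩU hx)]
    rw [ofReal_integral_eq_lintegral_ofReal hint (ae_of_all _ fun x => by positivity),
      ← lintegral_enorm_pow_four_eq]
    refine lintegral_congr fun x => ?_
    rw [ENNReal.ofReal_pow (norm_nonneg _), ofReal_norm]
  -- the right-hand side in `ℝ≥0∞`
  have hI2 : ENNReal.ofReal (∫ x in Ω, (‖fderiv ℝ h x v‖ ^ 2 + ‖fderiv ℝ (fun y => fderiv ℝ h y v)
      x‖ ^ 2)) =
      eLpNorm w 2 μ ^ 2 + eLpNorm Dw 2 μ ^ 2 := by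
    have hint : IntegrableOn (fun x => ‖fderiv ℝ h x v‖ ^ 2 + ‖fderiv ℝ (fun y => fderiv ℝ h y v)
        x‖ ^ 2)
        Ω volume := by
      refine IntegrableOn.congr_fun (integrableOn_cylinderCell_of_continuousOn_closure L
        (((hwKs.continuousOn.norm).pow 2).add ((hDwKc.norm).pow 2))) (fun x hx => ?_) hΩm
      show ‖wK x‖ ^ 2 + ‖DwK x‖ ^ 2 = ‖fderiv ℝ h x v‖ ^ 2 + ‖fderiv ℝ (fun y => fderiv ℝ h y v) x‖
          ^ 2
      rw [hwU (hΩU hx), hDwU (hΩU hx)]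
    rw [ofReal_integral_eq_lintegral_ofReal hint (ae_of_all _ fun x => by positivity)]
    have e1 : ∀ x, ENNReal.ofReal (‖fderiv ℝ h x v‖ ^ 2 + ‖fderiv ℝ (fun y => fderiv ℝ h y v) x‖ ^
        2) =
        ‖w x‖ₑ ^ 2 + ‖Dw x‖ₑ ^ 2 := fun x => by
      rw [ENNReal.ofReal_add (by positivity) (by positivity), ENNReal.ofReal_pow (norm_nonneg _),
        ENNReal.ofReal_pow (norm_nonneg _), ofReal_norm, ofReal_norm]
    simp_rw [e1]
    rw [lintegral_add_left' (hw_meas.enorm.pow_const 2), lintegral_enorm_sq_eq_eLpNorm_two_sq,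
      lintegral_enorm_sq_eq_eLpNorm_two_sq]
  -- Sobolev bounds for the right-hand side
  set N : ℝ≥0∞ := eSobolevDomainNorm 2 2 (cylinderCell L) volume h with hN
  have hw2 : eLpNorm w 2 μ ≤ N := eLpNorm_fderiv_basis_le_eSobolevDomainNorm 2 one_le_two i hhΩ
  have hDw2 : eLpNorm Dw 2 μ ≤ C₂ * N := by
    have h1 := hC₂ 0 hwsΩ
    rw [eSobolevDomainNorm_zero] at h1
    refine h1.trans (mul_le_mul' le_rfl ?_)
    exact eSobolevDomainNorm_fderiv_basis_le_succ 2 1 i hhΩ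
  have hRHS : eLpNorm w 2 μ ^ 2 + eLpNorm Dw 2 μ ^ 2 ≤ (1 + (C₂ : ℝ≥0∞) ^ 2) * N ^ 2 := by
    calc eLpNorm w 2 μ ^ 2 + eLpNorm Dw 2 μ ^ 2 ≤ N ^ 2 + ((C₂ : ℝ≥0∞) * N) ^ 2 := by
          gcongr
      _ = (1 + (C₂ : ℝ≥0∞) ^ 2) * N ^ 2 := by ring
  -- `M²` in `ℝ≥0∞`
  have hM2 : ENNReal.ofReal (M ^ 2) = S ^ 2 := by
    rw [ENNReal.ofReal_pow hM0, hM_def, ENNReal.ofReal_toReal hSfin.ne]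
  -- the constant of the direction `i`
  have hci : (c i : ℝ≥0∞) = ENNReal.ofReal (C₁ * ‖v‖ ^ 2) * (1 + (C₂ : ℝ≥0∞) ^ 2) := by
    simp only [hc, ENNReal.ofReal, hv]
    push_cast
    ring
  -- combine
  have hmain : (eLpNorm w 4 μ ^ 2) ^ 2 ≤ (c i : ℝ≥0∞) * (S * N) ^ 2 := by
    have hI2_nonneg : 0 ≤ ∫ x in Ω, (‖fderiv ℝ h x v‖ ^ 2 + ‖fderiv ℝ (fun y => fderiv ℝ h y v) x‖
        ^ 2) :=
      setIntegral_nonneg hΩm fun x _ => by positivity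
    calc (eLpNorm w 4 μ ^ 2) ^ 2 = eLpNorm w 4 μ ^ 4 := by ring
      _ = ENNReal.ofReal (∫ x in Ω, ‖fderiv ℝ h x v‖ ^ 4) := hI4.symm
      _ ≤ ENNReal.ofReal (C₁ * M ^ 2 * ‖v‖ ^ 2 *
            ∫ x in Ω, (‖fderiv ℝ h x v‖ ^ 2 + ‖fderiv ℝ (fun y => fderiv ℝ h y v) x‖ ^ 2)) :=
          ENNReal.ofReal_le_ofReal hGN'
      _ = ENNReal.ofReal (C₁ * ‖v‖ ^ 2) * ENNReal.ofReal (M ^ 2) *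
            ENNReal.ofReal (∫ x in Ω, (‖fderiv ℝ h x v‖ ^ 2 +
              ‖fderiv ℝ (fun y => fderiv ℝ h y v) x‖ ^ 2)) := by
          rw [← ENNReal.ofReal_mul (by positivity), ← ENNReal.ofReal_mul (by positivity)]
          congr 1
          ring
      _ = ENNReal.ofReal (C₁ * ‖v‖ ^ 2) * S ^ 2 * (eLpNorm w 2 μ ^ 2 + eLpNorm Dw 2 μ ^ 2) := by
          rw [hM2, hI2]
      _ ≤ ENNReal.ofReal (C₁ * ‖v‖ ^ 2) * S ^ 2 * ((1 + (C₂ : ℝ≥0∞) ^ 2) * N ^ 2) := by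
          gcongr
      _ = (c i : ℝ≥0∞) * (S * N) ^ 2 := by
          rw [hci]
          ring
  -- `c i ≤ 1 + Σ c` and `1 ≤ 1 + Σ c`
  have hcC : (c i : ℝ≥0∞) ≤ ((1 + ∑ j, c j : ℝ≥0) : ℝ≥0∞) := by
    have : c i ≤ 1 + ∑ j, c j :=
      le_add_left (Finset.single_le_sum (f := c) (fun _ _ => zero_le) (Finset.mem_univ i))
    exact_mod_cast this
  have hC1 : (1 : ℝ≥0∞) ≤ ((1 + ∑ j, c j : ℝ≥0) : ℝ≥0∞) := by
    have : (1 : ℝ≥0) ≤ 1 + ∑ j, c j := le_self_add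
    exact_mod_cast this
  have hfin := ennreal_le_mul_of_sq_le_mul_sq hmain hcC hC1
  calc eLpNorm w 4 μ ^ 2 ≤ ((1 + ∑ j, c j : ℝ≥0) : ℝ≥0∞) * (S * N) := hfin
    _ = ((1 + ∑ j, c j : ℝ≥0) : ℝ≥0∞) * S * N := by ring

end L4

/-! ### Hölder bookkeeping -/

section Holder

variable {α : Type*} {m0 : MeasurableSpace α} {ν : Measure α}
variable {G : Type*} [NormedAddCommGroup G] [NormedSpace ℝ G]

/-- `‖φ ψ‖_{L²} ≤ ‖φ‖_{L²} ‖ψ‖_{L^∞}` for a scalar `φ` and a vector `ψ`. [folklore] -/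
theorem eLpNorm_fun_smul_le_two_top {φ : α → ℝ} {ψ : α → G} (hφ : AEStronglyMeasurable φ ν) :
    eLpNorm (fun x => φ x • ψ x) 2 ν ≤ eLpNorm φ 2 ν * eLpNorm ψ ∞ ν :=
  eLpNorm_smul_le_eLpNorm_mul_eLpNorm_top 2 ψ hφ

/-- `‖φ ψ‖_{L²} ≤ ‖φ‖_{L^∞} ‖ψ‖_{L²}` for a scalar `φ` and a vector `ψ`. [folklore] -/
theorem eLpNorm_fun_smul_le_top_two {φ : α → ℝ} {ψ : α → G} (hψ : AEStronglyMeasurable ψ ν) :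
    eLpNorm (fun x => φ x • ψ x) 2 ν ≤ eLpNorm φ ∞ ν * eLpNorm ψ 2 ν :=
  eLpNorm_smul_le_eLpNorm_top_mul_eLpNorm 2 hψ φ

/-- `‖φ ψ‖_{L²} ≤ ‖φ‖_{L⁴} ‖ψ‖_{L⁴}` for a scalar `φ` and a vector `ψ` (Hölder with
`1/4 + 1/4 = 1/2`). [folklore] -/
theorem eLpNorm_fun_smul_le_four_four {φ : α → ℝ} {ψ : α → G} (hφ : AEStronglyMeasurable φ ν)
    (hψ : AEStronglyMeasurable ψ ν) :
    eLpNorm (fun x => φ x • ψ x) 2 ν ≤ eLpNorm φ 4 ν * eLpNorm ψ 4 ν := by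
  haveI : ENNReal.HolderTriple 4 4 2 := by
    refine ⟨?_⟩
    have h4 : (4 : ℝ≥0∞)⁻¹ = 2⁻¹ * 2⁻¹ := by
      rw [← ENNReal.mul_inv (Or.inl two_ne_zero) (Or.inl ENNReal.ofNat_ne_top)]; norm_num
    rw [h4, ← two_mul, ← mul_assoc, ENNReal.mul_inv_cancel two_ne_zero ENNReal.ofNat_ne_top,
        one_mul]
  exact eLpNorm_smul_le_mul_eLpNorm hψ hφ

omit [NormedSpace ℝ G] in
/-- The triangle inequality in `L²` for a pointwise sum. [folklore] -/
theorem eLpNorm_fun_add_le_two {f g : α → G} (hf : AEStronglyMeasurable f ν)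
    (hg : AEStronglyMeasurable g ν) :
    eLpNorm (fun x => f x + g x) 2 ν ≤ eLpNorm f 2 ν + eLpNorm g 2 ν :=
  eLpNorm_add_le hf hg one_le_two

/-- `z² ≤ P Q` gives `z ≤ P + Q` in `ℝ≥0∞` (a crude arithmetic–geometric mean inequality).
[folklore] -/
theorem ennreal_le_add_of_sq_le_mul {z P Q : ℝ≥0∞} (h : z ^ 2 ≤ P * Q) : z ≤ P + Q := by
  rcases le_total P Q with hPQ | hQP
  · have h2 : z ^ 2 ≤ Q ^ 2 := h.trans (by rw [sq]; exact mul_le_mul' hPQ le_rfl)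
    exact ((ENNReal.pow_le_pow_left_iff two_ne_zero).1 h2).trans le_add_self
  · have h2 : z ^ 2 ≤ P ^ 2 := h.trans (by rw [sq]; exact mul_le_mul' le_rfl hQP)
    exact ((ENNReal.pow_le_pow_left_iff two_ne_zero).1 h2).trans le_self_add

end Holder

/-! ### The discharge -/

/-- **Ferrari's Lemma 1 ii) holds in the periodic cylinder** (`s = 3`): discharge of
`Ferrari1993_periodicCylinderMoserInequality` —
`‖D_w(f g) − f D_w g‖_{L²(cell)} ≤ C (‖f‖_{H³(cell)} ‖g‖_{L^∞(cell)} + ‖f‖_{W^{1,∞}(cell)} ‖g‖_{H²(cell)})`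
for `f` scalar, `g` vector valued, both `C^∞` on the closed cylinder and `L`-periodic, and words
`|w| ≤ 3`. Proof: the Leibniz expansions `iterDeriv_{one,two,three}_smul_sub_apply` on the open
cylinder (which carries the cell up to a null set), the triangle inequality in `L²(cell)`, Hölder
`L² × L^∞`, `L^∞ × L²` for the extreme terms and `L⁴ × L⁴` with
`exists_sq_eLpNorm_four_fderiv_le_cylinderCell` (applied to `∂ₐ f`, realised on the closed cylinder
as `fderivWithin`, and to `g`) for the middle terms `f_{ab} g_c`; the constant is
`7 max(1, C_f C_g)`. [cite: Ferrari1993, Lemma 1 ii) p. 280] -/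
theorem Ferrari1993_periodicCylinderMoserInequality_holds :
    Ferrari1993_periodicCylinderMoserInequality := by
  intro L hL
  obtain ⟨Cg, hCg⟩ := exists_sq_eLpNorm_four_fderiv_le_cylinderCell (F := (EuclideanSpace ℝ (Fin
      3))) hL
  obtain ⟨Cf, hCf⟩ := exists_sq_eLpNorm_four_fderiv_le_cylinderCell (F := ℝ) hL
  set C₁ : ℝ≥0 := max 1 (Cf * Cg) with hC₁
  refine ⟨7 * C₁, ?_⟩
  intro f g hf hg hfper hgper m hm w
  revert w
  -- notation
  set ι := Fin (Module.finrank ℝ (EuclideanSpace ℝ (Fin 3))) with hι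
  set b : Module.Basis ι ℝ (EuclideanSpace ℝ (Fin 3)) := Module.finBasis ℝ (EuclideanSpace ℝ (Fin
      3)) with hb
  set K : Set (EuclideanSpace ℝ (Fin 3)) := closure (unitCylinder : Set (EuclideanSpace ℝ (Fin 3)))
      with hK_def
  set Ω : Set (EuclideanSpace ℝ (Fin 3)) := (cylinderCell L : Set (EuclideanSpace ℝ (Fin 3))) with
      hΩ_def
  set μ : Measure (EuclideanSpace ℝ (Fin 3)) := volume.restrict Ω with hμ
  have hKu : UniqueDiffOn ℝ K := uniqueDiffOn_closure_unitCylinder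
  have hU : IsOpen (unitCylinder : Set (EuclideanSpace ℝ (Fin 3))) := unitCylinder.isOpen
  have hΩU : Ω ⊆ (unitCylinder : Set (EuclideanSpace ℝ (Fin 3))) := cylinderCell_le_unitCylinder L
  have hΩm : MeasurableSet Ω := (cylinderCell L).isOpen.measurableSet
  have hnhds : ∀ x ∈ (unitCylinder : Set (EuclideanSpace ℝ (Fin 3))), K ∈ 𝓝 x := fun x hx =>
      closure_unitCylinder_mem_nhds hx
  have hfU : ContDiffOn ℝ ∞ f (unitCylinder : Set (EuclideanSpace ℝ (Fin 3))) := hf.mono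
      subset_closure
  have hgU : ContDiffOn ℝ ∞ g (unitCylinder : Set (EuclideanSpace ℝ (Fin 3))) := hg.mono
      subset_closure
  have hfΩ : ContDiffOn ℝ ∞ f (cylinderCell L) := hfU.mono hΩU
  have hgΩ : ContDiffOn ℝ ∞ g (cylinderCell L) := hgU.mono hΩU
  -- smoothness of the derivative fields on the open cylinder
  have sf1 : ∀ i, ContDiffOn ℝ ∞ (fun x => fderiv ℝ f x (b i)) (unitCylinder : Set (EuclideanSpace
      ℝ (Fin 3))) := fun i =>
    contDiffOn_fderiv_apply_of_isOpen hU hfU (b i)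
  have sf2 : ∀ i j, ContDiffOn ℝ ∞ (fun x => fderiv ℝ (fun y => fderiv ℝ f y (b i)) x (b j))
      (unitCylinder : Set (EuclideanSpace ℝ (Fin 3))) := fun i j =>
          contDiffOn_fderiv_apply_of_isOpen hU (sf1 i) (b j)
  have sf3 : ∀ i j l, ContDiffOn ℝ ∞
      (fun x => fderiv ℝ (fun y => fderiv ℝ (fun z => fderiv ℝ f z (b i)) y (b j)) x (b l))
      (unitCylinder : Set (EuclideanSpace ℝ (Fin 3))) := fun i j l =>
          contDiffOn_fderiv_apply_of_isOpen hU (sf2 i j) (b l)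
  have sg1 : ∀ i, ContDiffOn ℝ ∞ (fun x => fderiv ℝ g x (b i)) (unitCylinder : Set (EuclideanSpace
      ℝ (Fin 3))) := fun i =>
    contDiffOn_fderiv_apply_of_isOpen hU hgU (b i)
  have sg2 : ∀ i j, ContDiffOn ℝ ∞ (fun x => fderiv ℝ (fun y => fderiv ℝ g y (b i)) x (b j))
      (unitCylinder : Set (EuclideanSpace ℝ (Fin 3))) := fun i j =>
          contDiffOn_fderiv_apply_of_isOpen hU (sg1 i) (b j)
  -- measurability of products on the cell
  have meas : ∀ {φ : (EuclideanSpace ℝ (Fin 3)) → ℝ} {ψ : (EuclideanSpace ℝ (Fin 3)) →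
      (EuclideanSpace ℝ (Fin 3))}, ContinuousOn φ (unitCylinder : Set (EuclideanSpace ℝ (Fin 3))) →
      ContinuousOn ψ (unitCylinder : Set (EuclideanSpace ℝ (Fin 3))) → AEStronglyMeasurable (fun x
          => φ x • ψ x) μ :=
    fun hφ hψ => aestronglyMeasurable_cylinderCell_of_continuousOn L (hφ.smul hψ)
  have measv : ∀ {ψ : (EuclideanSpace ℝ (Fin 3)) → (EuclideanSpace ℝ (Fin 3))}, ContinuousOn ψ
      (unitCylinder : Set (EuclideanSpace ℝ (Fin 3))) → AEStronglyMeasurable ψ μ :=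
    fun hψ => aestronglyMeasurable_cylinderCell_of_continuousOn L hψ
  have meass : ∀ {φ : (EuclideanSpace ℝ (Fin 3)) → ℝ}, ContinuousOn φ (unitCylinder : Set
      (EuclideanSpace ℝ (Fin 3))) → AEStronglyMeasurable φ μ :=
    fun hφ => aestronglyMeasurable_cylinderCell_of_continuousOn L hφ
  -- the four sizes
  set N3f : ℝ≥0∞ := eSobolevDomainNorm 3 2 (cylinderCell L) volume f with hN3f
  set N0g : ℝ≥0∞ := eSobolevDomainNorm 0 ∞ (cylinderCell L) volume g with hN0g
  set N1f : ℝ≥0∞ := eSobolevDomainNorm 1 ∞ (cylinderCell L) volume f with hN1f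
  set N2g : ℝ≥0∞ := eSobolevDomainNorm 2 2 (cylinderCell L) volume g with hN2g
  set R : ℝ≥0∞ := N3f * N0g + N1f * N2g with hR
  -- one-factor bounds
  have hf1_top : ∀ i, eLpNorm (fun x => fderiv ℝ f x (b i)) ∞ μ ≤ N1f := fun i =>
    eLpNorm_fderiv_basis_le_eSobolevDomainNorm ∞ le_rfl i hfΩ
  have hf1_2 : ∀ i, eLpNorm (fun x => fderiv ℝ f x (b i)) 2 μ ≤ N3f := fun i =>
    eLpNorm_fderiv_basis_le_eSobolevDomainNorm 2 (by norm_num) i hfΩ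
  have hf2_2 : ∀ i j, eLpNorm (fun x => fderiv ℝ (fun y => fderiv ℝ f y (b i)) x (b j)) 2 μ ≤ N3f :=
    fun i j => eLpNorm_fderiv_fderiv_basis_le_eSobolevDomainNorm 2 (by norm_num) i j hfΩ
  have hf3_2 : ∀ i j l, eLpNorm
      (fun x => fderiv ℝ (fun y => fderiv ℝ (fun z => fderiv ℝ f z (b i)) y (b j)) x (b l)) 2 μ ≤
          N3f :=
    fun i j l => eLpNorm_fderiv_fderiv_fderiv_basis_le_eSobolevDomainNorm 2 le_rfl i j l hfΩ
  have hg0 : eLpNorm g ∞ μ = N0g := rfl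
  have hg1_2 : ∀ i, eLpNorm (fun x => fderiv ℝ g x (b i)) 2 μ ≤ N2g := fun i =>
    eLpNorm_fderiv_basis_le_eSobolevDomainNorm 2 (by norm_num) i hgΩ
  have hg2_2 : ∀ i j, eLpNorm (fun x => fderiv ℝ (fun y => fderiv ℝ g y (b i)) x (b j)) 2 μ ≤ N2g :=
    fun i j => eLpNorm_fderiv_fderiv_basis_le_eSobolevDomainNorm 2 le_rfl i j hgΩ
  -- the `L⁴` bounds
  have hg1_4 : ∀ i, eLpNorm (fun x => fderiv ℝ g x (b i)) 4 μ ^ 2 ≤ Cg * N0g * N2g := fun i =>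
    hCg g hg hgper i
  have hf2_4 : ∀ i j, eLpNorm (fun x => fderiv ℝ (fun y => fderiv ℝ f y (b i)) x (b j)) 4 μ ^ 2 ≤
      Cf * N1f * N3f := by
    intro i j
    set h : (EuclideanSpace ℝ (Fin 3)) → ℝ := fun x => fderivWithin ℝ f K x (b i) with hh_def
    have hhs : ContDiffOn ℝ ∞ h K := (hf.fderivWithin hKu (by simp)).clm_apply contDiffOn_const
    have hhper : IsAxiallyPeriodic L h := isAxiallyPeriodic_fderivWithin_apply hfper (b i)
    have hhU : EqOn h (fun x => fderiv ℝ f x (b i)) (unitCylinder : Set (EuclideanSpace ℝ (Fin 3)))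
        := fun x hx => by
      show fderivWithin ℝ f K x (b i) = fderiv ℝ f x (b i)
      rw [fderivWithin_of_mem_nhds (hnhds x hx)]
    have key := hCf h hhs hhper j
    -- identify the three norms
    have e1 : eLpNorm (fun x => fderiv ℝ h x (b j)) 4 μ =
        eLpNorm (fun x => fderiv ℝ (fun y => fderiv ℝ f y (b i)) x (b j)) 4 μ := by
      refine eLpNorm_congr_ae (ae_restrict_of_forall_mem hΩm fun x hx => ?_)
      show fderiv ℝ h x (b j) = fderiv ℝ (fun y => fderiv ℝ f y (b i)) x (b j)
      rw [(eventuallyEq_of_mem (hU.mem_nhds (hΩU hx)) hhU).fderiv_eq]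
    have e2 : eLpNorm h ∞ μ ≤ N1f := by
      rw [eLpNorm_congr_ae (ae_restrict_of_forall_mem hΩm fun x hx => hhU (hΩU hx))]
      exact hf1_top i
    have e3 : eSobolevDomainNorm 2 2 (cylinderCell L) volume h ≤ N3f := by
      rw [SobolevApprox.eSobolevDomainNorm_congr (fun x hx => hhU (hΩU hx))]
      exact eSobolevDomainNorm_fderiv_basis_le_succ 2 2 i hfΩ
    rw [e1] at key
    calc _ ≤ (Cf : ℝ≥0∞) * eLpNorm h ∞ μ * eSobolevDomainNorm 2 2 (cylinderCell L) volume h := key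
      _ ≤ Cf * N1f * N3f := by gcongr
  -- the three types of terms
  have hC₁1 : (1 : ℝ≥0∞) ≤ C₁ := by
    have : (1 : ℝ≥0) ≤ C₁ := le_max_left _ _
    exact_mod_cast this
  have hC₁2 : ((Cf * Cg : ℝ≥0) : ℝ≥0∞) ≤ C₁ := by
    have : Cf * Cg ≤ C₁ := le_max_right _ _
    exact_mod_cast this
  have hRC : R ≤ C₁ * R := le_mul_of_one_le_left (zero_le) hC₁1
  have typeA : ∀ {φ : (EuclideanSpace ℝ (Fin 3)) → ℝ}, ContinuousOn φ (unitCylinder : Set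
      (EuclideanSpace ℝ (Fin 3))) → eLpNorm φ 2 μ ≤ N3f →
      eLpNorm (fun x => φ x • g x) 2 μ ≤ C₁ * R := by
    intro φ hφc hφ
    calc eLpNorm (fun x => φ x • g x) 2 μ ≤ eLpNorm φ 2 μ * eLpNorm g ∞ μ :=
          eLpNorm_fun_smul_le_two_top (meass hφc)
      _ ≤ N3f * N0g := by rw [hg0]; gcongr
      _ ≤ R := le_self_add
      _ ≤ C₁ * R := hRC
  have typeB : ∀ (i) {ψ : (EuclideanSpace ℝ (Fin 3)) → (EuclideanSpace ℝ (Fin 3))}, ContinuousOn ψ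
      (unitCylinder : Set (EuclideanSpace ℝ (Fin 3))) → eLpNorm ψ 2 μ ≤ N2g →
      eLpNorm (fun x => fderiv ℝ f x (b i) • ψ x) 2 μ ≤ C₁ * R := by
    intro i ψ hψc hψ
    calc eLpNorm (fun x => fderiv ℝ f x (b i) • ψ x) 2 μ
        ≤ eLpNorm (fun x => fderiv ℝ f x (b i)) ∞ μ * eLpNorm ψ 2 μ :=
          eLpNorm_fun_smul_le_top_two (measv hψc)
      _ ≤ N1f * N2g := by gcongr; exact hf1_top i
      _ ≤ R := le_add_self
      _ ≤ C₁ * R := hRC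
  have typeM : ∀ i j l, eLpNorm (fun x => fderiv ℝ (fun y => fderiv ℝ f y (b i)) x (b j) •
      fderiv ℝ g x (b l)) 2 μ ≤ C₁ * R := by
    intro i j l
    have h1 : eLpNorm (fun x => fderiv ℝ (fun y => fderiv ℝ f y (b i)) x (b j) • fderiv ℝ g x (b
        l)) 2 μ ≤
        eLpNorm (fun x => fderiv ℝ (fun y => fderiv ℝ f y (b i)) x (b j)) 4 μ *
          eLpNorm (fun x => fderiv ℝ g x (b l)) 4 μ :=
      eLpNorm_fun_smul_le_four_four (meass (sf2 i j).continuousOn) (measv (sg1 l).continuousOn)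
    have h2 : (eLpNorm (fun x => fderiv ℝ (fun y => fderiv ℝ f y (b i)) x (b j)) 4 μ *
          eLpNorm (fun x => fderiv ℝ g x (b l)) 4 μ) ^ 2 ≤
        ((Cf * Cg : ℝ≥0) * (N3f * N0g)) * (N1f * N2g) := by
      calc _ = eLpNorm (fun x => fderiv ℝ (fun y => fderiv ℝ f y (b i)) x (b j)) 4 μ ^ 2 *
            eLpNorm (fun x => fderiv ℝ g x (b l)) 4 μ ^ 2 := by ring
        _ ≤ ((Cf : ℝ≥0∞) * N1f * N3f) * ((Cg : ℝ≥0∞) * N0g * N2g) :=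
            mul_le_mul' (hf2_4 i j) (hg1_4 l)
        _ = ((Cf * Cg : ℝ≥0) * (N3f * N0g)) * (N1f * N2g) := by push_cast; ring
    have h3 := ennreal_le_add_of_sq_le_mul h2
    calc _ ≤ _ := h1
      _ ≤ (Cf * Cg : ℝ≥0) * (N3f * N0g) + N1f * N2g := h3
      _ ≤ C₁ * (N3f * N0g) + C₁ * (N1f * N2g) :=
          add_le_add (mul_le_mul' hC₁2 le_rfl) (le_mul_of_one_le_left (zero_le) hC₁1)
      _ = C₁ * R := by rw [hR, mul_add]
  -- continuity of the factors, for measurability of the sums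
  have cf1 : ∀ i, ContinuousOn (fun x => fderiv ℝ f x (b i)) (unitCylinder : Set (EuclideanSpace ℝ
      (Fin 3))) := fun i =>
    (sf1 i).continuousOn
  have cf2 : ∀ i j, ContinuousOn (fun x => fderiv ℝ (fun y => fderiv ℝ f y (b i)) x (b j))
      (unitCylinder : Set (EuclideanSpace ℝ (Fin 3))) := fun i j => (sf2 i j).continuousOn
  have cf3 : ∀ i j l, ContinuousOn
      (fun x => fderiv ℝ (fun y => fderiv ℝ (fun z => fderiv ℝ f z (b i)) y (b j)) x (b l))
      (unitCylinder : Set (EuclideanSpace ℝ (Fin 3))) := fun i j l => (sf3 i j l).continuousOn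
  have cg0 : ContinuousOn g (unitCylinder : Set (EuclideanSpace ℝ (Fin 3))) := hgU.continuousOn
  have cg1 : ∀ i, ContinuousOn (fun x => fderiv ℝ g x (b i)) (unitCylinder : Set (EuclideanSpace ℝ
      (Fin 3))) := fun i =>
    (sg1 i).continuousOn
  have cg2 : ∀ i j, ContinuousOn (fun x => fderiv ℝ (fun y => fderiv ℝ g y (b i)) x (b j))
      (unitCylinder : Set (EuclideanSpace ℝ (Fin 3))) := fun i j => (sg2 i j).continuousOn
  -- the final constant dominates `k C₁ R` for `k ≤ 7`
  have hfinal : ∀ {X : ℝ≥0∞} (k : ℕ), k ≤ 7 → X ≤ k * (C₁ * R) → X ≤ ((7 * C₁ : ℝ≥0) : ℝ≥0∞) * R :=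
      by
    intro X k hk hX
    refine hX.trans ?_
    push_cast
    rw [mul_assoc]
    gcongr
    exact_mod_cast hk
  -- case analysis on the length of the word
  obtain rfl | rfl | rfl | rfl : m = 0 ∨ m = 1 ∨ m = 2 ∨ m = 3 := by omega
  · -- the empty word: the commutator vanishes
    intro w
    have h0 : (fun x => iterDeriv 0 (sobolevDir w) (fun y => f y • g y) x -
        f x • iterDeriv 0 (sobolevDir w) g x) = fun _ => 0 := by
      funext x
      simp
    rw [h0, eLpNorm_zero']
    exact zero_le
  · -- words of length one: one term of type A
    intro w
    have hid : (fun x => iterDeriv 1 (sobolevDir w) (fun y => f y • g y) x -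
        f x • iterDeriv 1 (sobolevDir w) g x) =ᵐ[μ] fun x => fderiv ℝ f x (b (w 0)) • g x :=
      ae_restrict_of_forall_mem hΩm fun x hx =>
        iterDeriv_one_smul_sub_apply hU hfU hgU (sobolevDir w) (hΩU hx)
    rw [eLpNorm_congr_ae hid]
    refine hfinal 1 (by norm_num) ?_
    rw [Nat.cast_one, one_mul]
    exact typeA (cf1 (w 0)) (hf1_2 (w 0))
  · -- words of length two: three terms
    intro w
    have hid : (fun x => iterDeriv 2 (sobolevDir w) (fun y => f y • g y) x -
        f x • iterDeriv 2 (sobolevDir w) g x) =ᵐ[μ] fun x =>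
          fderiv ℝ (fun y => fderiv ℝ f y (b (w 0))) x (b (w 1)) • g x +
          fderiv ℝ f x (b (w 0)) • fderiv ℝ g x (b (w 1)) +
          fderiv ℝ f x (b (w 1)) • fderiv ℝ g x (b (w 0)) :=
      ae_restrict_of_forall_mem hΩm fun x hx =>
        iterDeriv_two_smul_sub_apply hU hfU hgU (sobolevDir w) (hΩU hx)
    rw [eLpNorm_congr_ae hid]
    refine hfinal 3 (by norm_num) ?_
    have m1 := meas (cf2 (w 0) (w 1)) cg0
    have m2 := meas (cf1 (w 0)) (cg1 (w 1))
    have m3 := meas (cf1 (w 1)) (cg1 (w 0))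
    calc _ ≤ _ := eLpNorm_fun_add_le_two (m1.add m2) m3
      _ ≤ _ := add_le_add (eLpNorm_fun_add_le_two m1 m2) le_rfl
      _ ≤ C₁ * R + C₁ * R + C₁ * R :=
          add_le_add (add_le_add (typeA (cf2 (w 0) (w 1)) (hf2_2 (w 0) (w 1)))
            (typeB (w 0) (cg1 (w 1)) (hg1_2 (w 1)))) (typeB (w 1) (cg1 (w 0)) (hg1_2 (w 0)))
      _ = (3 : ℕ) * (C₁ * R) := by push_cast; ring
  · -- words of length three: seven terms
    intro w
    have hid : (fun x => iterDeriv 3 (sobolevDir w) (fun y => f y • g y) x -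
        f x • iterDeriv 3 (sobolevDir w) g x) =ᵐ[μ] fun x =>
          fderiv ℝ (fun y => fderiv ℝ (fun z => fderiv ℝ f z (b (w 0))) y (b (w 1))) x (b (w 2)) •
              g x +
          fderiv ℝ (fun z => fderiv ℝ f z (b (w 0))) x (b (w 1)) • fderiv ℝ g x (b (w 2)) +
          fderiv ℝ (fun z => fderiv ℝ f z (b (w 0))) x (b (w 2)) • fderiv ℝ g x (b (w 1)) +
          fderiv ℝ f x (b (w 0)) • fderiv ℝ (fun z => fderiv ℝ g z (b (w 1))) x (b (w 2)) +
          fderiv ℝ (fun z => fderiv ℝ f z (b (w 1))) x (b (w 2)) • fderiv ℝ g x (b (w 0)) +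
          fderiv ℝ f x (b (w 1)) • fderiv ℝ (fun z => fderiv ℝ g z (b (w 0))) x (b (w 2)) +
          fderiv ℝ f x (b (w 2)) • fderiv ℝ (fun z => fderiv ℝ g z (b (w 0))) x (b (w 1)) :=
      ae_restrict_of_forall_mem hΩm fun x hx =>
        iterDeriv_three_smul_sub_apply hU hfU hgU (sobolevDir w) (hΩU hx)
    rw [eLpNorm_congr_ae hid]
    refine hfinal 7 le_rfl ?_
    have m1 := meas (cf3 (w 0) (w 1) (w 2)) cg0
    have m2 := meas (cf2 (w 0) (w 1)) (cg1 (w 2))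
    have m3 := meas (cf2 (w 0) (w 2)) (cg1 (w 1))
    have m4 := meas (cf1 (w 0)) (cg2 (w 1) (w 2))
    have m5 := meas (cf2 (w 1) (w 2)) (cg1 (w 0))
    have m6 := meas (cf1 (w 1)) (cg2 (w 0) (w 2))
    have m7 := meas (cf1 (w 2)) (cg2 (w 0) (w 1))
    have b1 := typeA (cf3 (w 0) (w 1) (w 2)) (hf3_2 (w 0) (w 1) (w 2))
    have b2 := typeM (w 0) (w 1) (w 2)
    have b3 := typeM (w 0) (w 2) (w 1)
    have b4 := typeB (w 0) (cg2 (w 1) (w 2)) (hg2_2 (w 1) (w 2))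
    have b5 := typeM (w 1) (w 2) (w 0)
    have b6 := typeB (w 1) (cg2 (w 0) (w 2)) (hg2_2 (w 0) (w 2))
    have b7 := typeB (w 2) (cg2 (w 0) (w 1)) (hg2_2 (w 0) (w 1))
    calc _ ≤ _ := eLpNorm_fun_add_le_two (((((m1.add m2).add m3).add m4).add m5).add m6) m7
      _ ≤ _ := add_le_add (eLpNorm_fun_add_le_two ((((m1.add m2).add m3).add m4).add m5) m6) le_rfl
      _ ≤ _ := add_le_add (add_le_add (eLpNorm_fun_add_le_two (((m1.add m2).add m3).add m4) m5)
          le_rfl) le_rfl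
      _ ≤ _ := add_le_add (add_le_add (add_le_add (eLpNorm_fun_add_le_two ((m1.add m2).add m3) m4)
          le_rfl) le_rfl) le_rfl
      _ ≤ _ := add_le_add (add_le_add (add_le_add (add_le_add
          (eLpNorm_fun_add_le_two (m1.add m2) m3) le_rfl) le_rfl) le_rfl) le_rfl
      _ ≤ _ := add_le_add (add_le_add (add_le_add (add_le_add (add_le_add
          (eLpNorm_fun_add_le_two m1 m2) le_rfl) le_rfl) le_rfl) le_rfl) le_rfl
      _ ≤ C₁ * R + C₁ * R + C₁ * R + C₁ * R + C₁ * R + C₁ * R + C₁ * R :=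
          add_le_add (add_le_add (add_le_add (add_le_add (add_le_add (add_le_add b1 b2) b3) b4)
            b5) b6) b7
      _ = (7 : ℕ) * (C₁ * R) := by push_cast; ring


/-! ### Consequences: the commutator estimate and the `H³` bound on two named facts -/

/-- **`Ferrari1993_periodicCylinderCommutatorEstimate` holds** (from Lemma 1 ii),
`Ferrari1993_periodicCylinderCommutatorEstimate_of_moser`). Primed name: the unprimed one is left
to a direct proof of the applied estimate. [cite: Ferrari1993, Lemma 1 ii) and the display following it, p. 280] -/
theorem Ferrari1993_periodicCylinderCommutatorEstimate_holds' :
    Ferrari1993_periodicCylinderCommutatorEstimate :=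
  Ferrari1993_periodicCylinderCommutatorEstimate_of_moser
      Ferrari1993_periodicCylinderMoserInequality_holds

/-- **`Ferrari1993_periodicCylinderHsEnergyInequality` from Lemma 2 alone** (the pressure
estimate), Lemma 1 ii) being proved. [cite: Ferrari1993, (8)–(14) with Lemmas 1–2, pp. 280–281] -/
theorem Ferrari1993_periodicCylinderHsEnergyInequality_of_pressure
    (hP : Ferrari1993_periodicCylinderPressureEstimate) :
    Ferrari1993_periodicCylinderHsEnergyInequality :=
  Ferrari1993_periodicCylinderHsEnergyInequality_of_moser_of_pressure
    Ferrari1993_periodicCylinderMoserInequality_holds hP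

/-- **The a-priori `H³` bound `Ferrari1993_periodicCylinderH3Bound` from Lemma 2 and the stationary
log div–curl estimate** — the trust base after this file. [cite: Ferrari1993, §1 proof of Thm 2, (4) ⇒ (7) = (17) (pp. 279–282)] -/
theorem Ferrari1993_periodicCylinderH3Bound_of_pressure_of_divCurl
    (hP : Ferrari1993_periodicCylinderPressureEstimate)
    (hB1 : ShirotaYanagisawa1993_periodicCylinderLogDivCurlEstimate) :
    Ferrari1993_periodicCylinderH3Bound :=
  Ferrari1993_periodicCylinderH3Bound_of_moser_of_pressure_of_divCurl
    Ferrari1993_periodicCylinderMoserInequality_holds hP hB1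

/-- **Continuation past a time of bounded vorticity from Lemma 2, the stationary log div–curl
estimate and Kato–Lai's uniform-time existence.** [cite: Ferrari1993, Thm 2 (p. 279) and its proof pp. 279–283] -/
theorem Ferrari1993_periodicCylinderContinuation_of_pressure_of_divCurl
    (hP : Ferrari1993_periodicCylinderPressureEstimate)
    (hB1 : ShirotaYanagisawa1993_periodicCylinderLogDivCurlEstimate)
    (hE : KatoLai1984_periodicCylinderUniformExistence) :
    Ferrari1993_periodicCylinderContinuation :=
  Ferrari1993_periodicCylinderContinuation_of_moser_of_pressure_of_divCurl
    Ferrari1993_periodicCylinderMoserInequality_holds hP hB1 hE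

/-- **The BKM criterion in the periodic cylinder from Lemma 2, the stationary log div–curl
estimate and Kato–Lai's uniform-time existence.** [cite: Ferrari1993, Thms 1–2 (p. 279)] -/
theorem Ferrari1993_periodicCylinderEulerBKM_of_pressure_of_divCurl
    (hP : Ferrari1993_periodicCylinderPressureEstimate)
    (hB1 : ShirotaYanagisawa1993_periodicCylinderLogDivCurlEstimate)
    (hE : KatoLai1984_periodicCylinderUniformExistence) : Ferrari1993_periodicCylinderEulerBKM :=
  Ferrari1993_periodicCylinderEulerBKM_of_moser_of_pressure_of_divCurl
    Ferrari1993_periodicCylinderMoserInequality_holds hP hB1 hE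

/-- **The Chen–Hou blow-up from Lemma 2, the stationary log div–curl estimate, Kato–Lai's
uniform-time existence and Chen–Hou's a-priori blow-up estimates.** [cite: arXiv221007191, §1 Theorem 2 (p. 3) and §6.1 Theorem 4 (p. 54)] -/
theorem chen_hou_blowup_of_pressure_of_divCurl
    (hP : Ferrari1993_periodicCylinderPressureEstimate)
    (hB1 : ShirotaYanagisawa1993_periodicCylinderLogDivCurlEstimate)
    (hE : KatoLai1984_periodicCylinderUniformExistence)
    (hCH : ChenHou2022_aprioriBlowupEstimates) : chen_hou_blowup :=
  chen_hou_blowup_of_moser_of_pressure_of_divCurl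
    Ferrari1993_periodicCylinderMoserInequality_holds hP hB1 hE hCH

end Literature.Analysis.FluidPDE
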